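import Mathlib
import HarnessLib
import Summits.ResolutionOfSingularities.ResolutionOfSingularities.Theorems.WildQuotientsWildQuotientResolutionBlowupExitBasicOpenSections
import Summits.ResolutionOfSingularities.ResolutionOfSingularities.Theorems.WildQuotientsWildQuotientResolutionConductorOneFrameNormInv

/-!
# S2 brick F3c-2b — the FRAME of the conductor-𝟙 core: the INVARIANT norm element `N_{i,I} = W_{i,I} t^{D}` with
# `D₊(N_{i,I}) = O_{i,I}`

(crux stmt-ResolutionOfSingularities-15640 `WildQuotients.WildQuotientResolution`, line `Sketch`; chain w45c post-V5
programme S2, design `L/res-L1-w45c-lead-1/S2-DESIGN.md` §1 («O_{i,ε} = D₊(s_{i,ε}) basic opens of degree p·n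
monomials», «seam Ω per piece via `BlowupExit.exists_basicOpen_sectionsEquiv`») / §6 brick F3; res-L1-w45c-plan-1
NO OBJECTION 2026-08-27T18:26:16Z. [OURS · L1 W4.5c] — NOT a statement of any manuscript; replaces the role of no
printed item; AI-produced, weaker than expert review. Def-free. Prover res-D-pv-033.)

`N_{i,I} := (uᵢt)^p·wᵢ · ∏_{l ∈ I∖i} (u_l t)^p·w_l · ∏_{l ∉ I} ((uᵢ−u_l)t)^p·wᵢw_l ∈ R[𝔪t]` (`w_l = (1 − u_l^{p−1})⁻¹`):
* `coe_normElt` — `N_{i,I} = monomial D W_{i,I}`, `D = p + |I∖i|·p + |Iᶜ|·p`, `W_{i,I}` the radicand of F3c-2a;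
  `normElt_mem` (degree `D`), `normElt_deg_pos`;
* **`basicOpen_normElt_eq`** — `D₊(N_{i,I}) = O_{i,I}` (= `D₊(pieceElt i I)` of F3b: powers and unit factors do not
  change a basic open);
* **`reesGradedHom_normElt_eq`** — `φ_γ N_{i,I} = N_{i,I}` for the coefficientwise Rees automorphisms `φ_γ`
  (`BlowupExit.exists_reesGradedHom_family`), since the radicand is `⟨σ⟩`-invariant (`smul_pieceRadicand`);
  `powers_normElt_le_comap` — the `hP` of the seam engine.
-/

-- single-problem summit: the doubled namespace component `ResolutionOfSingularities` is forced
set_option linter.dupNamespace false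

noncomputable section

open CategoryTheory AlgebraicGeometry MvPolynomial Polynomial
open scoped Pointwise
open Literature.AlgebraicGeometry.Resolution

universe u

namespace Summit.ResolutionOfSingularities.ResolutionOfSingularities.Theorems.WildQuotientResolution

namespace BlowupExit

/-- A product of monomials of the same degree. [folklore] -/
theorem prod_monomial_const_deg {R : Type*} [CommSemiring R] {ι : Type*} [DecidableEq ι] (S : Finset ι)
    (a : ℕ) (x : ι → R) : ∏ l ∈ S, monomial a (x l) = monomial (S.card * a) (∏ l ∈ S, x l) := by
  induction S using Finset.induction_on with
  | empty => simp
  | insert b S hb ih =>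
    rw [Finset.prod_insert hb, Finset.prod_insert hb, ih, Polynomial.monomial_mul_monomial,
      Finset.card_insert_of_notMem hb, Nat.succ_mul, add_comm]

/-- **A unit factor of degree zero does not change a Rees chart**: `D₊(x · c) = D₊(x)` for a unit `c` of `R`.
[folklore] -/
theorem basicOpen_mul_algebraMap_unit {R : Type u} [CommRing R] {I : Ideal R} (x : reesAlgebra I) (c : Rˣ) :
    Proj.basicOpen (reesGrading I) (x * algebraMap R (reesAlgebra I) (c : R)) =
      Proj.basicOpen (reesGrading I) x := by
  have hunit : IsUnit (algebraMap R (reesAlgebra I) (c : R)) := (Units.isUnit c).map _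
  obtain ⟨v, hv⟩ := hunit.exists_right_inv
  have htop : Proj.basicOpen (reesGrading I) (algebraMap R (reesAlgebra I) (c : R)) = ⊤ := by
    apply top_le_iff.mp
    calc (⊤ : (Proj (reesGrading I)).Opens) = Proj.basicOpen (reesGrading I) 1 := (Proj.basicOpen_one _).symm
      _ = Proj.basicOpen (reesGrading I) (algebraMap R (reesAlgebra I) (c : R) * v) := by rw [hv]
      _ ≤ _ := by rw [Proj.basicOpen_mul]; exact inf_le_left
  rw [Proj.basicOpen_mul, htop, inf_top_eq]

end BlowupExit

namespace ConductorOne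

variable (k : Type) [Field k] (p n : ℕ) [Fact p.Prime] [CharP k p]
  (σ : CoreRing k p n ≃ₐ[k] CoreRing k p n)
  (hσ : ∀ i, σ (coreU k p n i) * (1 + coreU k p n i) = coreU k p n i)

/-- the Rees generator `uₗ t` -/
local notation3 (prettyPrint := false) "uT" l =>
  reesT (I := Ideal.span (Set.range (coreU k p n))) (coreU k p n l)
    (Ideal.mem_span_range_self (f := coreU k p n) (x := l))
/-- the Rees element `(uᵢ − uₗ) t` -/
local notation3 (prettyPrint := false) "dT" i:max l:max =>
  reesT (I := Ideal.span (Set.range (coreU k p n))) (coreU k p n i - coreU k p n l)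
    (Ideal.sub_mem _ (Ideal.mem_span_range_self (f := coreU k p n) (x := i))
      (Ideal.mem_span_range_self (f := coreU k p n) (x := l)))
/-- the Rees chart `D₊(y)` -/
local notation3 (prettyPrint := false) "D₊" y =>
  Proj.basicOpen (reesGrading (Ideal.span (Set.range (coreU k p n)))) y
/-- the piece element of F3b -/
local notation3 (prettyPrint := false) "pieceElt" i:max I:max =>
  (uT i) * (∏ l ∈ Finset.erase I i, (uT l)) * (∏ l ∈ Finset.univ \ I, (dT i l))
/-- the inverse `w_l = (1 − u_l^{p−1})⁻¹` in `Aₙ` -/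
local notation3 (prettyPrint := false) "cw" l => (((isUnit_coreFactor k p n l).unit⁻¹ : (CoreRing k p n)ˣ) :
  CoreRing k p n)
/-- the norm radicand `N_{il}` -/
local notation3 (prettyPrint := false) "nD" i:max l:max =>
  ((coreU k p n i - coreU k p n l) ^ p * ((cw i) * (cw l)))
/-- the piece radicand `W_{i,I}` -/
local notation3 (prettyPrint := false) "pieceRad" i:max I:max =>
  (coreT k p n i * (∏ l ∈ Finset.erase I i, coreT k p n l) * (∏ l ∈ Finset.univ \ I, (nD i l)))
/-- the norm factor `(u_l t)^p · w_l` -/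
local notation3 (prettyPrint := false) "nT" l =>
  ((uT l) ^ p * algebraMap (CoreRing k p n) (reesAlgebra (Ideal.span (Set.range (coreU k p n))))
    (((isUnit_coreFactor k p n l).unit⁻¹ : (CoreRing k p n)ˣ) : CoreRing k p n))
/-- the norm factor `((uᵢ−u_l) t)^p · wᵢ w_l` -/
local notation3 (prettyPrint := false) "nDT" i:max l:max =>
  ((dT i l) ^ p * algebraMap (CoreRing k p n) (reesAlgebra (Ideal.span (Set.range (coreU k p n))))
    ((((isUnit_coreFactor k p n i).unit⁻¹ * (isUnit_coreFactor k p n l).unit⁻¹ : (CoreRing k p n)ˣ)) :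
      CoreRing k p n))
/-- the norm element `N_{i,I}` -/
local notation3 (prettyPrint := false) "normElt" i:max I:max =>
  ((nT i) * (∏ l ∈ Finset.erase I i, (nT l)) * (∏ l ∈ Finset.univ \ I, (nDT i l)))

/-! ## The monomial form -/

omit [Fact p.Prime] [CharP k p] in
/-- `(u_l t)^p w_l = T_l t^p`. [OURS · L1 W4.5c] -/
theorem coe_normFactorT (l : Fin n) :
    ((nT l : reesAlgebra (Ideal.span (Set.range (coreU k p n)))) : (CoreRing k p n)[X]) =
      monomial p (coreT k p n l) := by
  rw [Subalgebra.coe_mul, Subalgebra.coe_pow, coe_reesT, Subalgebra.coe_algebraMap, Polynomial.algebraMap_eq,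
    Polynomial.monomial_pow, one_mul, Polynomial.monomial_mul_C]
  rfl

omit [Fact p.Prime] [CharP k p] in
/-- `((uᵢ−u_l) t)^p wᵢ w_l = N_{il} t^p`. [OURS · L1 W4.5c] -/
theorem coe_normFactorD (i l : Fin n) :
    ((nDT i l : reesAlgebra (Ideal.span (Set.range (coreU k p n)))) : (CoreRing k p n)[X]) =
      monomial p (nD i l) := by
  rw [Subalgebra.coe_mul, Subalgebra.coe_pow, coe_reesT, Subalgebra.coe_algebraMap, Polynomial.algebraMap_eq,
    Polynomial.monomial_pow, one_mul, Polynomial.monomial_mul_C, Units.val_mul]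

omit [Fact p.Prime] [CharP k p] in
/-- **`N_{i,I} = W_{i,I} t^D`**, `D = p + |I∖i|·p + |Iᶜ|·p`. [OURS · L1 W4.5c] -/
theorem coe_normElt (i : Fin n) (I : Finset (Fin n)) :
    ((normElt i I : reesAlgebra (Ideal.span (Set.range (coreU k p n)))) : (CoreRing k p n)[X]) =
      monomial (p + (I.erase i).card * p + (Finset.univ \ I).card * p) (pieceRad i I) := by
  rw [Subalgebra.coe_mul, Subalgebra.coe_mul, SubmonoidClass.coe_finsetProd, SubmonoidClass.coe_finsetProd,
    coe_normFactorT]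
  simp_rw [coe_normFactorT, coe_normFactorD]
  rw [BlowupExit.prod_monomial_const_deg, BlowupExit.prod_monomial_const_deg, Polynomial.monomial_mul_monomial,
    Polynomial.monomial_mul_monomial]

omit [Fact p.Prime] [CharP k p] in
/-- `N_{i,I}` is homogeneous of degree `D`. [OURS · L1 W4.5c] -/
theorem normElt_mem (i : Fin n) (I : Finset (Fin n)) :
    (normElt i I) ∈ reesGrading (Ideal.span (Set.range (coreU k p n)))
      (p + (I.erase i).card * p + (Finset.univ \ I).card * p) :=
  (mem_reesGrading_iff _).mpr ⟨_, (coe_normElt k p n i I).symm⟩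

omit [CharP k p] in
/-- `0 < D`. [OURS · L1 W4.5c] -/
theorem normElt_deg_pos (i : Fin n) (I : Finset (Fin n)) :
    0 < p + (I.erase i).card * p + (Finset.univ \ I).card * p := by
  have := (Fact.out : p.Prime).pos; omega

/-! ## Same basic open -/

omit [CharP k p] in
/-- **`D₊(N_{i,I}) = O_{i,I}`.** [OURS · L1 W4.5c] -/
theorem basicOpen_normElt_eq (i : Fin n) (I : Finset (Fin n)) :
    (D₊ (normElt i I)) = (D₊ (pieceElt i I)) := by
  have hp : 0 < p := (Fact.out : p.Prime).pos
  have hT : ∀ l : Fin n, (D₊ (nT l)) = (D₊ (uT l)) := fun l => by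
    rw [BlowupExit.basicOpen_mul_algebraMap_unit, Proj.basicOpen_pow _ _ _ hp]
  have hD : ∀ l : Fin n, (D₊ (nDT i l)) = (D₊ (dT i l)) := fun l => by
    rw [BlowupExit.basicOpen_mul_algebraMap_unit, Proj.basicOpen_pow _ _ _ hp]
  rw [piece_eq_inf]
  rw [Proj.basicOpen_mul, Proj.basicOpen_mul, BlowupExit.basicOpen_finset_prod, BlowupExit.basicOpen_finset_prod,
    hT i]
  simp_rw [hT, hD]

/-! ## Invariance under the coefficientwise Rees automorphisms -/

include hσ in
/-- **`φ_γ N_{i,I} = N_{i,I}`** for every coefficientwise Rees automorphism `φ_γ` (acting by `γ⁻¹` on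
coefficients). [OURS · L1 W4.5c] -/
theorem reesGradedHom_normElt_eq
    (φ : ↥(Subgroup.zpowers σ) → (reesGrading (Ideal.span (Set.range (coreU k p n))) →+*ᵍ
      reesGrading (Ideal.span (Set.range (coreU k p n)))))
    (hφ : ∀ (γ : ↥(Subgroup.zpowers σ)) (x : reesAlgebra (Ideal.span (Set.range (coreU k p n)))),
      ((φ γ x : reesAlgebra (Ideal.span (Set.range (coreU k p n)))) : (CoreRing k p n)[X]) =
        (x : (CoreRing k p n)[X]).map ((MulSemiringAction.toRingEquiv (↥(Subgroup.zpowers σ))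
          (CoreRing k p n) γ⁻¹ : CoreRing k p n ≃+* CoreRing k p n) : CoreRing k p n →+* CoreRing k p n))
    (γ : ↥(Subgroup.zpowers σ)) (i : Fin n) (I : Finset (Fin n)) :
    φ γ (normElt i I) = (normElt i I) :=
  BlowupExit.reesGradedHom_eq_self_of_monomial _ _ (coe_normElt k p n i I) (φ γ) _ (hφ γ)
    (smul_pieceRadicand k p n σ hσ γ⁻¹ i I)

include hσ in
/-- The powers of `N_{i,I}` are mapped into themselves by every `φ_γ` (the `hP` of the seam). [OURS · L1 W4.5c] -/
theorem powers_normElt_le_comap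
    (φ : ↥(Subgroup.zpowers σ) → (reesGrading (Ideal.span (Set.range (coreU k p n))) →+*ᵍ
      reesGrading (Ideal.span (Set.range (coreU k p n)))))
    (hφ : ∀ (γ : ↥(Subgroup.zpowers σ)) (x : reesAlgebra (Ideal.span (Set.range (coreU k p n)))),
      ((φ γ x : reesAlgebra (Ideal.span (Set.range (coreU k p n)))) : (CoreRing k p n)[X]) =
        (x : (CoreRing k p n)[X]).map ((MulSemiringAction.toRingEquiv (↥(Subgroup.zpowers σ))
          (CoreRing k p n) γ⁻¹ : CoreRing k p n ≃+* CoreRing k p n) : CoreRing k p n →+* CoreRing k p n))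
    (γ : ↥(Subgroup.zpowers σ)) (i : Fin n) (I : Finset (Fin n)) :
    Submonoid.powers (normElt i I) ≤ (Submonoid.powers (normElt i I)).comap (φ γ) :=
  BlowupExit.powers_le_comap_of_monomial _ _ (coe_normElt k p n i I) (φ γ) _ (hφ γ)
    (smul_pieceRadicand k p n σ hσ γ⁻¹ i I)

end ConductorOne

end Summit.ResolutionOfSingularities.ResolutionOfSingularities.Theorems.WildQuotientResolution

end
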